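import Summits.Ventures.YMGap.RobustBall.LoopObservable
import Literature.Probability.LatticeModels.PerfectMatchingCount
import HarnessLib

/-!
# Venture YMGap, track ROBUST-BALL — translating lattice walks on `ℤ^d`: edge sets and an `ℓ^∞` extent bound

HONEST FRAMING. WHAT THIS IS: a venture file (cell `pub-ymgap`, track Y2 ROBUST-BALL, seat rb-p1), elementary
lattice geometry feeding the translation-invariant loop actions of `ShapeLoopFamily.lean`: walks of the
nearest-neighbour graph `zdGraph d` are translated by the tree's graph automorphism `zdGraphShiftIso v` (`x ↦ x + v`,
Mathlib `Walk.map`); we record the oriented edge of a translated dart (`dartStep_mapDart_shift`), the edge set of a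
translated walk (`walkEdges_map_shift` = the translate of the edge set; membership form
`mem_walkEdges_map_shift_iff`), and the extent bound: every vertex of a walk from `x` is within `ℓ^∞`-distance
`|w|` of `x`, so two links of one walk are within `2|w|` (`norm_sub_le_two_mul_length_of_mem_walkEdges`).
WHAT IT IS NOT: no measure, no gauge field, no number; nothing about the continuum limit or the Clay problem.

References: translations of `ℤ^d` as graph automorphisms are the tree's (`LatticeModels/PerfectMatchingCount.lean`,
`zdGraphShiftIso`, after Friedli–Velenik 2017 §3.1). [folklore]
-/

noncomputable section

open Function SimpleGraph
open Literature.Probability.LatticeModels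
open Literature.MathematicalPhysics.QuantumLattice
open Literature.MathematicalPhysics.QuantumFieldTheory (walkEdges)

namespace Summit.Ventures.YMGap.RobustBall

variable {d : ℕ}

/-! ### Translated darts -/

section Darts

variable (v : Site d)

/-- The translation homomorphism acts as `x ↦ x + v`. -/
@[simp] theorem shift_toHom_apply (x : Site d) : (zdGraphShiftIso v).toEmbedding.toHom x = x + v := rfl

/-- Endpoints of a translated dart. -/
theorem mapDart_shift_fst (a : (zdGraph d).Dart) :
    ((zdGraphShiftIso v).toEmbedding.toHom.mapDart a).fst = a.fst + v := rfl

/-- Endpoints of a translated dart. -/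
theorem mapDart_shift_snd (a : (zdGraph d).Dart) :
    ((zdGraphShiftIso v).toEmbedding.toHom.mapDart a).snd = a.snd + v := rfl

/-- Translation preserves the coordinate direction of a dart. -/
theorem dartDir_mapDart_shift (a : (zdGraph d).Dart) :
    dartDir ((zdGraphShiftIso v).toEmbedding.toHom.mapDart a) = dartDir a := by
  refine Dart.dir_unique (dartDir_spec _) ?_
  rw [mapDart_shift_fst, mapDart_shift_snd]
  rcases dartDir_spec a with h | h
  · exact Or.inl (by rw [h, add_right_comm])
  · exact Or.inr (by rw [h, add_right_comm])

/-- **The oriented edge of a translated dart** is the translated oriented edge, with the same orientation. -/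
theorem dartStep_mapDart_shift (a : (zdGraph d).Dart) :
    dartStep ((zdGraphShiftIso v).toEmbedding.toHom.mapDart a) =
      (((dartStep a).1.1 + v, (dartStep a).1.2), (dartStep a).2) := by
  have hdir := dartDir_mapDart_shift v a
  rcases dartDir_spec a with h | h
  · have hs : dartStep a = ((a.fst, dartDir a), true) := by
      unfold dartStep; rw [if_pos h]
    have h' : ((zdGraphShiftIso v).toEmbedding.toHom.mapDart a).snd =
        ((zdGraphShiftIso v).toEmbedding.toHom.mapDart a).fst +
          Pi.single (dartDir ((zdGraphShiftIso v).toEmbedding.toHom.mapDart a)) 1 := by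
      rw [hdir, mapDart_shift_fst, mapDart_shift_snd, h, add_right_comm]
    have hs' : dartStep ((zdGraphShiftIso v).toEmbedding.toHom.mapDart a) =
        ((((zdGraphShiftIso v).toEmbedding.toHom.mapDart a).fst,
          dartDir ((zdGraphShiftIso v).toEmbedding.toHom.mapDart a)), true) := by
      unfold dartStep; rw [if_pos h']
    rw [hs', hs, hdir, mapDart_shift_fst]
  · have hne : ¬ a.snd = a.fst + Pi.single (dartDir a) 1 := fun h' => not_snd_eq_and_fst_eq _ _ _ h' h
    have hs : dartStep a = ((a.snd, dartDir a), false) := by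
      unfold dartStep; rw [if_neg hne]
    have hne' : ¬ ((zdGraphShiftIso v).toEmbedding.toHom.mapDart a).snd =
        ((zdGraphShiftIso v).toEmbedding.toHom.mapDart a).fst +
          Pi.single (dartDir ((zdGraphShiftIso v).toEmbedding.toHom.mapDart a)) 1 := by
      rw [hdir, mapDart_shift_fst, mapDart_shift_snd, add_right_comm, add_left_inj]
      exact hne
    have hs' : dartStep ((zdGraphShiftIso v).toEmbedding.toHom.mapDart a) =
        ((((zdGraphShiftIso v).toEmbedding.toHom.mapDart a).snd,
          dartDir ((zdGraphShiftIso v).toEmbedding.toHom.mapDart a)), false) := by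
      unfold dartStep; rw [if_neg hne']
    rw [hs', hs, hdir, mapDart_shift_snd]

end Darts

/-! ### Edge sets of translated walks -/

section Edges

variable (v : Site d)

/-- **The edge set of a translated walk is the translated edge set.** -/
theorem walkEdges_map_shift {x y : Site d} (w : (zdGraph d).Walk x y) :
    walkEdges (w.map (zdGraphShiftIso v).toEmbedding.toHom) = (walkEdges w).image fun e => (e.1 + v, e.2) := by
  classical
  unfold walkEdges
  rw [Walk.darts_map, List.map_map]
  ext e
  simp only [List.mem_toFinset, List.mem_map, Function.comp_apply, Finset.mem_image, dartStep_mapDart_shift]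
  constructor
  · rintro ⟨a, ha, rfl⟩
    exact ⟨(dartStep a).1, ⟨a, ha, rfl⟩, rfl⟩
  · rintro ⟨e', ⟨a, ha, rfl⟩, rfl⟩
    exact ⟨a, ha, rfl⟩

/-- Membership form: `e` is an edge of the translate iff `e - v` is an edge of the walk. -/
theorem mem_walkEdges_map_shift_iff {x y : Site d} (w : (zdGraph d).Walk x y) (e : ZdEdge d) :
    e ∈ walkEdges (w.map (zdGraphShiftIso v).toEmbedding.toHom) ↔ (e.1 - v, e.2) ∈ walkEdges w := by
  rw [walkEdges_map_shift, Finset.mem_image]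
  constructor
  · rintro ⟨e', he', rfl⟩
    simpa using he'
  · intro h
    exact ⟨(e.1 - v, e.2), h, by simp⟩

end Edges

/-! ### Extent of a walk in the `ℓ^∞` norm -/

section Extent

/-- Adjacent sites of `ℤ^d` are at `ℓ^∞`-distance at most `1`. -/
theorem norm_sub_le_one_of_adj {x y : Site d} (h : (zdGraph d).Adj x y) : ‖y - x‖ ≤ 1 := by
  obtain ⟨i, h | h⟩ := (zdGraph_adj_iff x y).1 h
  · rw [h, add_sub_cancel_left, Pi.norm_single, Int.norm_eq_abs]; simp
  · rw [h, sub_add_cancel_left, norm_neg, Pi.norm_single, Int.norm_eq_abs]; simp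

/-- **Every vertex of a walk is within `ℓ^∞`-distance `|w|` of its start.** -/
theorem norm_sub_le_length_of_mem_support :
    ∀ {x y : Site d} (w : (zdGraph d).Walk x y) {z : Site d}, z ∈ w.support → ‖z - x‖ ≤ w.length
  | _, _, .nil, z, hz => by
    rw [Walk.support_nil, List.mem_singleton] at hz
    subst hz; simp
  | x, _, .cons (v := x') hadj p, z, hz => by
    rw [Walk.support_cons, List.mem_cons] at hz
    rcases hz with rfl | hz
    · rw [sub_self, norm_zero, Walk.length_cons]; positivity
    · have h1 := norm_sub_le_length_of_mem_support p hz
      have h2 := norm_sub_le_one_of_adj hadj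
      rw [Walk.length_cons, Nat.cast_succ]
      calc ‖z - x‖ = ‖(z - x') + (x' - x)‖ := by rw [sub_add_sub_cancel]
        _ ≤ ‖z - x'‖ + ‖x' - x‖ := norm_add_le _ _
        _ ≤ p.length + 1 := add_le_add h1 h2

/-- The base point of an oriented edge of a walk is a vertex of the walk. -/
theorem fst_mem_support_of_mem_walkEdges {x y : Site d} (w : (zdGraph d).Walk x y) {e : ZdEdge d}
    (he : e ∈ walkEdges w) : e.1 ∈ w.support := by
  unfold walkEdges at he
  rw [List.mem_toFinset, List.mem_map] at he
  obtain ⟨a, ha, rfl⟩ := he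
  rcases dartDir_spec a with h | h
  · have hs : dartStep a = ((a.fst, dartDir a), true) := by
      unfold dartStep; rw [if_pos h]
    rw [hs]
    exact w.dart_fst_mem_support_of_mem_darts ha
  · have hne : ¬ a.snd = a.fst + Pi.single (dartDir a) 1 := fun h' => not_snd_eq_and_fst_eq _ _ _ h' h
    have hs : dartStep a = ((a.snd, dartDir a), false) := by
      unfold dartStep; rw [if_neg hne]
    rw [hs]
    exact w.dart_snd_mem_support_of_mem_darts ha

/-- **Two links of one walk are within `ℓ^∞`-distance `2|w|`.** -/
theorem norm_sub_le_two_mul_length_of_mem_walkEdges {x y : Site d} (w : (zdGraph d).Walk x y) {e e' : ZdEdge d}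
    (he : e ∈ walkEdges w) (he' : e' ∈ walkEdges w) : ‖e.1 - e'.1‖ ≤ 2 * w.length := by
  have h1 := norm_sub_le_length_of_mem_support w (fst_mem_support_of_mem_walkEdges w he)
  have h2 := norm_sub_le_length_of_mem_support w (fst_mem_support_of_mem_walkEdges w he')
  calc ‖e.1 - e'.1‖ = ‖(e.1 - x) - (e'.1 - x)‖ := by rw [sub_sub_sub_cancel_right]
    _ ≤ ‖e.1 - x‖ + ‖e'.1 - x‖ := norm_sub_le _ _
    _ ≤ w.length + w.length := add_le_add h1 h2
    _ = 2 * w.length := by ring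

end Extent

end Summit.Ventures.YMGap.RobustBall

end
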